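import Mathlib
import Summits.Ventures.HodgeRepro.Tier4.Common.AdelicDefs
import Summits.Ventures.HodgeRepro.Tier4.Common.AdelicPlaces
import Summits.Ventures.HodgeRepro.Tier4.Common.AdelicHaar
import Summits.Ventures.HodgeRepro.Tier4.Common.UnitaryDet
import Summits.Ventures.HodgeRepro.Tier4.Line1.HaarModulus
import Summits.Ventures.HodgeRepro.Tier4.Line1.ModulusVecMul
import Summits.Ventures.HodgeRepro.Tier4.Line1.ModulusEmbed
import Summits.Ventures.HodgeRepro.Tier4.Line1.AdelicSingle
import Summits.Ventures.HodgeRepro.Tier4.Line1.AdelicModulusBase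

/-!
# Tier4/Line1/AdelicModulus — THE LOCAL-GLOBAL MODULUS FORMULA on `𝔸_k^ι` and the rung C5 «the adelic modulus»
of the cocompactness cut of LINE L1

Blind re-derivation cell `pub-hodge-repro`, Tier 4 (README §9–§10), seat t4-L2-p2 (gen 2), wall-breaker on the
cocompactness rung C5 of LINE L1 (t4-L1-p5's `I1c-rungs-sig.lean` L52 `measure_vecMul_GA`; lead S12733 «C5/C7 —
NOT assignable until a place-decomposition interface exists»; claim S12815).  Target tree path
`lean/Summits/Ventures/HodgeRepro/Tier4/Line1/AdelicModulus.lean`.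

THE FORMULA (`modulus_vecMulEquiv_eq_modUnit_det`): for every `M ∈ GL_ι(𝔸_k)` and every Haar measure `μ` on
`𝔸_k^ι`, the Haar modulus of `x ↦ x ᵥ* M` equals the modulus of multiplication by `det M` on `𝔸_k` — by induction
on a finite set of places outside which `M` is trivial (archimedean) / integral with integral inverse (finite): at
each place `v` of the set, `M = E_v · M′` with `E_v` = «`M_v` at `v`, the identity elsewhere» (whose modulus is the
determinant modulus by the transvection–diagonal decomposition of `M_v` over the FIELD `k_v`, `ModulusEmbed`) and
`M′` trivial at `v`, unchanged elsewhere; the base case is `AdelicModulusBase`.  No absolute value, no product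
formula, no restricted-product decomposition of `GL_ι(𝔸_k)` is used.

THE RUNG (`measure_vecMul_GA`): for `g ∈ U(W)(𝔸_k)` with `det W.B ≠ 0`, `(det g)² = 1` (typer-2's
`GA.det_sq_eq_one`), hence `modUnit (det g)² = 1`, hence `modUnit (det g) = 1`, hence `x ↦ x ᵥ* g` preserves every
Haar measure on `𝔸_k⁴`: `μ ((· ᵥ* g) '' S) = μ S` for EVERY set `S`.  The hypothesis `hB : W.B.det ≠ 0` is the ONE
repair of the signature of `I1c-rungs-sig.lean` L52 (without it the statement is false: for `W.B = 0` the scalar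
matrices `a • 1`, `a ∈ 𝔸_k^×`, lie in `unitaryGroup W` and scale Haar measure by `modUnit a ^ 4`).

Nothing here asserts anything about the Hodge conjecture for CM abelian varieties, which is NOT proved (HC_CM is NOT
proved by anyone in this repository).
-/

set_option autoImplicit false

noncomputable section

namespace Summit.Ventures.HodgeRepro.Tier4.Line1

open NumberField IsDedekindDomain HeightOneSpectrum MeasureTheory Measure Topology Matrix Common
open scoped NumberField RestrictedProduct ENNReal NNReal

section Induction

variable {k : Type} [Field k] [NumberField k] {ι : Type*} [Fintype ι] [DecidableEq ι]
variable [MeasurableSpace (Ad k)] [BorelSpace (Ad k)] (ν : Measure (Ad k)) [ν.IsAddHaarMeasure]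
  (μ : Measure (ι → Ad k)) [μ.IsAddHaarMeasure]

/-- **Stripping one place**: if `M′ := E⁻¹ * M` has the determinant modulus, where `E` is «the `v`-component of `M`
at `v`, the identity elsewhere» for a non-unital ring homomorphism `s` (an adele supported at `v`), then so does `M`. -/
theorem hasDetModulus_of_strip {F : Type*} [Field F] (ev : Ad k →+* F) (s : F →ₙ+* Ad k)
    (M : (Matrix ι ι (Ad k))ˣ)
    (h : HasDetModulus μ ν ((Units.map (embMatHom s) (evUnits ev M))⁻¹ * M)) : HasDetModulus μ ν M := by
  have hE := hasDetModulus_embMat μ ν s (evUnits ev M)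
  have := hE.mul μ ν h
  rwa [mul_inv_cancel_left] at this

omit [Fintype ι] [MeasurableSpace (Ad k)] [BorelSpace (Ad k)] in
/-- The entries of the identity matrix are `v`-integral. -/
theorem one_apply_mem_adicCompletionIntegers (v : HeightOneSpectrum (𝓞 k)) (i j : ι) :
    (1 : Matrix ι ι (v.adicCompletion k)) i j ∈ v.adicCompletionIntegers k := by
  rw [Matrix.one_apply]
  split_ifs
  · exact one_mem _
  · exact zero_mem _

/-- **Induction over the finite places**: a matrix trivial at every infinite place and integral outside a finite set
`T` of finite places has the determinant modulus. -/
theorem hasDetModulus_of_trivial_of_integral_outside (T : Finset (HeightOneSpectrum (𝓞 k))) :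
    ∀ M : (Matrix ι ι (Ad k))ˣ, (∀ w, TrivialAtInf w M) → (∀ v ∉ T, IntegralAtFin v M) → HasDetModulus μ ν M := by
  classical
  induction T using Finset.induction_on with
  | empty =>
    intro M hinf hfin
    exact hasDetModulus_of_trivial_of_integral ν μ M hinf fun v => hfin v (Finset.notMem_empty v)
  | insert v T hv ih =>
    intro M hinf hfin
    apply hasDetModulus_of_strip ν μ (adComponentFin k v) (singleFin k v) M
    apply ih
    · intro w
      unfold TrivialAtInf
      rw [evUnits_inv_mul_of_ne _ _ _ (fun c => adComponentInf_singleFin k v w c)]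
      exact hinf w
    · intro v' hv'
      by_cases hvv : v' = v
      · subst hvv
        have h1 := evUnits_inv_mul_self (adComponentFin k v') (singleFin k v')
          (fun c => adComponentFin_singleFin_same k v' c) M
        refine ⟨fun i j => ?_, fun i j => ?_⟩
        · rw [h1]
          exact one_apply_mem_adicCompletionIntegers v' i j
        · rw [map_inv, h1, inv_one]
          exact one_apply_mem_adicCompletionIntegers v' i j
      · have hv'T : v' ∉ insert v T := by simp [hvv, hv']
        have h1 := evUnits_inv_mul_of_ne (adComponentFin k v) (adComponentFin k v') (singleFin k v)
          (fun c => adComponentFin_singleFin_of_ne k hvv c) M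
        refine ⟨fun i j => ?_, fun i j => ?_⟩
        · rw [h1]
          exact (hfin v' hv'T).1 i j
        · rw [map_inv, h1, ← map_inv]
          exact (hfin v' hv'T).2 i j

/-- **Induction over the infinite places**: a matrix trivial outside a finite set `S` of infinite places and integral
outside a finite set `T` of finite places has the determinant modulus. -/
theorem hasDetModulus_of_trivial_outside_of_integral_outside (S : Finset (InfinitePlace k))
    (T : Finset (HeightOneSpectrum (𝓞 k))) :
    ∀ M : (Matrix ι ι (Ad k))ˣ, (∀ w ∉ S, TrivialAtInf w M) → (∀ v ∉ T, IntegralAtFin v M) →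
      HasDetModulus μ ν M := by
  classical
  induction S using Finset.induction_on with
  | empty =>
    intro M hinf hfin
    exact hasDetModulus_of_trivial_of_integral_outside ν μ T M (fun w => hinf w (Finset.notMem_empty w)) hfin
  | insert w S hw ih =>
    intro M hinf hfin
    apply hasDetModulus_of_strip ν μ (adComponentInf k w) (singleInf k w) M
    apply ih
    · intro w' hw'
      by_cases hww : w' = w
      · subst hww
        exact evUnits_inv_mul_self (adComponentInf k w') (singleInf k w')
          (fun c => adComponentInf_singleInf_same k w' c) M
      · have hw'S : w' ∉ insert w S := by simp [hww, hw']
        unfold TrivialAtInf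
        rw [evUnits_inv_mul_of_ne _ _ _ (fun c => adComponentInf_singleInf_of_ne k hww c)]
        exact hinf w' hw'S
    · intro v hv
      have h1 := evUnits_inv_mul_of_ne (adComponentInf k w) (adComponentFin k v) (singleInf k w)
        (fun c => adComponentFin_singleInf k w v c) M
      refine ⟨fun i j => ?_, fun i j => ?_⟩
      · rw [h1]
        exact (hfin v hv).1 i j
      · rw [map_inv, h1, ← map_inv]
        exact (hfin v hv).2 i j

/-- **THE LOCAL-GLOBAL MODULUS FORMULA**: every `M ∈ GL_ι(𝔸_k)` has the determinant modulus. -/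
theorem hasDetModulus_adele (M : (Matrix ι ι (Ad k))ˣ) : HasDetModulus μ ν M := by
  obtain ⟨T, hT⟩ := exists_finset_integralAtFin M
  exact hasDetModulus_of_trivial_outside_of_integral_outside ν μ Finset.univ T M
    (fun w hw => absurd (Finset.mem_univ w) hw) hT

/-- **THE LOCAL-GLOBAL MODULUS FORMULA**, spelled out: the Haar modulus of `x ↦ x ᵥ* M` on `𝔸_k^ι` is the modulus
of multiplication by `det M` on `𝔸_k`. -/
theorem modulus_vecMulEquiv_eq_modUnit_det (M : (Matrix ι ι (Ad k))ˣ) :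
    modulus μ (vecMulEquiv M) = modUnit ν (detUnit M) :=
  hasDetModulus_adele ν μ M

include ν in
/-- If `(det M)² = 1` then `x ↦ x ᵥ* M` has modulus `1` (proved against any Haar measure `ν` on `𝔸_k`). -/
theorem modulus_vecMulEquiv_eq_one_of_det_sq_eq_one (M : (Matrix ι ι (Ad k))ˣ)
    (hM : det (M : Matrix ι ι (Ad k)) ^ 2 = 1) : modulus μ (vecMulEquiv M) = 1 := by
  rw [modulus_vecMulEquiv_eq_modUnit_det ν μ M]
  apply modUnit_eq_one_of_sq_eq_one
  ext
  rw [Units.val_pow_eq_pow_val, coe_detUnit, hM, Units.val_one]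

end Induction

section Rung

variable {k : Type} [Field k] [NumberField k] {ι : Type*} [Fintype ι] [DecidableEq ι]

/-- `𝔸_k` is Hausdorff (`Common.t2Space_adeleRing`), as an instance. -/
instance instT2SpaceAd : T2Space (Ad k) := t2Space_adeleRing k

/-- **Right multiplication by an adelic matrix with `(det M)² = 1` preserves every Haar measure on `𝔸_k^ι`**: the
push-forward of `μ` is `μ`. -/
theorem map_vecMul_eq_self_of_det_sq_eq_one [MeasurableSpace (Ad k)] [BorelSpace (Ad k)]
    (μ : Measure (ι → Ad k)) [μ.IsAddHaarMeasure] (M : (Matrix ι ι (Ad k))ˣ)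
    (hM : det (M : Matrix ι ι (Ad k)) ^ 2 = 1) :
    map (fun x : ι → Ad k => x ᵥ* (M : Matrix ι ι (Ad k))) μ = μ :=
  map_eq_of_modulus_eq_one μ (vecMulEquiv M)
    (modulus_vecMulEquiv_eq_one_of_det_sq_eq_one (Measure.addHaar : Measure (Ad k)) μ M hM)

/-- **Right multiplication by an adelic matrix with `(det M)² = 1` preserves the Haar measure of EVERY set.** -/
theorem measure_image_vecMul_eq_of_det_sq_eq_one [MeasurableSpace (Ad k)] [BorelSpace (Ad k)]
    (μ : Measure (ι → Ad k)) [μ.IsAddHaarMeasure] (M : (Matrix ι ι (Ad k))ˣ)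
    (hM : det (M : Matrix ι ι (Ad k)) ^ 2 = 1) (S : Set (ι → Ad k)) :
    μ ((fun x : ι → Ad k => x ᵥ* (M : Matrix ι ι (Ad k))) '' S) = μ S :=
  measure_image_eq_of_modulus_eq_one μ (vecMulEquiv M)
    (modulus_vecMulEquiv_eq_one_of_det_sq_eq_one (Measure.addHaar : Measure (Ad k)) μ M hM) S

variable (W : PlaneData k)

/-- **(C5) THE MODULUS — the rung `measure_vecMul_GA` of t4-L1-p5's cut (I1c-rungs-sig.lean L52), with the repair
`hB : W.B.det ≠ 0`**: right multiplication by `g ∈ U(W)(𝔸_k)` preserves every Haar measure on `𝔸_k⁴` — for EVERY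
set `S`, `μ ((· ᵥ* g) '' S) = μ S`.  Proof: `(det g)² = 1` (typer-2's `GA.det_sq_eq_one`) and the local-global
modulus formula; the Borel structure on `𝔸_k⁴` given by the rung is identified with the product of the Borel
structure of `𝔸_k` (both are `borel`, `Pi.borelSpace`). -/
theorem measure_vecMul_GA [m : MeasurableSpace (Fin 4 → Ad k)] [hb : BorelSpace (Fin 4 → Ad k)]
    (μ : Measure (Fin 4 → Ad k)) [μ.IsAddHaarMeasure] (hB : W.B.det ≠ 0) (g : GA W)
    (S : Set (Fin 4 → Ad k)) :
    μ ((fun x => Matrix.vecMul x (GA.mat W g)) '' S) = μ S := by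
  letI : MeasurableSpace (Ad k) := borel (Ad k)
  haveI : BorelSpace (Ad k) := ⟨rfl⟩
  have hm : m = MeasurableSpace.pi := by
    rw [hb.measurable_eq]
    exact (Pi.borelSpace (X := fun _ : Fin 4 => Ad k)).measurable_eq.symm
  subst hm
  exact measure_image_vecMul_eq_of_det_sq_eq_one μ ((g : GL4 k) : (Matrix (Fin 4) (Fin 4) (Ad k))ˣ)
    (GA.det_sq_eq_one W hB g) S

/-- The same rung in the push-forward form: `map (· ᵥ* g) μ = μ`. -/
theorem map_vecMul_GA [m : MeasurableSpace (Fin 4 → Ad k)] [hb : BorelSpace (Fin 4 → Ad k)]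
    (μ : Measure (Fin 4 → Ad k)) [μ.IsAddHaarMeasure] (hB : W.B.det ≠ 0) (g : GA W) :
    map (fun x => Matrix.vecMul x (GA.mat W g)) μ = μ := by
  letI : MeasurableSpace (Ad k) := borel (Ad k)
  haveI : BorelSpace (Ad k) := ⟨rfl⟩
  have hm : m = MeasurableSpace.pi := by
    rw [hb.measurable_eq]
    exact (Pi.borelSpace (X := fun _ : Fin 4 => Ad k)).measurable_eq.symm
  subst hm
  exact map_vecMul_eq_self_of_det_sq_eq_one μ ((g : GL4 k) : (Matrix (Fin 4) (Fin 4) (Ad k))ˣ)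
    (GA.det_sq_eq_one W hB g)

end Rung

end Summit.Ventures.HodgeRepro.Tier4.Line1

end
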